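import Mathlib.Analysis.Complex.BranchLogRoot
import Mathlib.Analysis.Complex.AbsMax
import Mathlib.Analysis.Complex.CauchyIntegral
import Mathlib.Analysis.Calculus.Deriv.Inverse
import Mathlib.Analysis.Calculus.InverseFunctionTheorem.Deriv
import Mathlib.Analysis.Calculus.ContDiff.RCLike
import Literature.Analysis.Complex.Hurwitz
import Literature.Analysis.Complex.Montel
import HarnessLib

/-!
# The Riemann mapping theorem

Trunk support (complex analysis), discharging the named fact
`Literature/Probability/RandomPlanarGeometry/ConformalMap.lean: Literature.exists_conformalEquiv_ball`
(see `Literature/Probability/RandomPlanarGeometry/ConformalMapProofs.lean`).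

**Riemann mapping theorem** (B. Riemann 1851, first complete proofs by W. F. Osgood 1900,
P. Koebe 1912, and the extremal proof of L. Fejér–F. Riesz 1922 as simplified by A. Ostrowski and
C. Carathéodory; textbook form: J. B. Conway, *Functions of one complex variable I*, 2nd ed.,
Ch. VII, Thm. 4.2; L. V. Ahlfors, *Complex Analysis*, 3rd ed., Ch. 6 §1.1 Thm. 1): every simply
connected open proper subset `U ⊊ ℂ` admits a holomorphic bijection onto the open unit disc, with
holomorphic inverse; given `z₀ ∈ U` it can be chosen with `f z₀ = 0`.

We follow Conway's proof of his Lemma VII.4.3 (the extremal problem `sup |f'(z₀)|` over the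
family of injective holomorphic `f : U → 𝔻` with `f z₀ = 0`):

* `Complex.discMobius a` — the disc automorphisms `φ_a(z) = (z - a)/(1 - conj a · z)`
  (Conway VI.2.2) and their elementary properties.
* `Complex.hasDerivAt_of_sq_eq` — a continuous square root of a holomorphic function is
  holomorphic (used with Mathlib's `Complex.exists_continuousOn_pow_eq`, the existence of continuous
  square roots of zero-free maps on simply connected domains).
* `Complex.differentiableOn_invFunOn_image` — the inverse of an injective holomorphic map with
  zero-free derivative is holomorphic on the (open) image (Conway IV.7.6, via the inverse function
  theorem).
* `Complex.exists_eqOn_const_or_injOn_of_tendstoLocallyUniformlyOn` — Hurwitz's corollary: a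
  locally uniform limit of injective holomorphic functions on a domain is constant or injective
  (Conway VII.4.3, proof of (4.5); from `Complex.hurwitz_eqOn_zero_or_forall_ne_zero`).
* `Complex.exists_mapsTo_ball_injOn` — Riemann mapping theorem, steps 1–2 (Conway VII.4.3, proof
  of (4.4); Koebe's square-root trick `√(z - a)`): an injective holomorphic map `U → 𝔻` with
  zero-free derivative exists. (Mathlib's `Analysis/Complex/RiemannMapping.lean` proves this as
  `Complex.exists_mapsTo_unitBall_injOn_deriv_ne_zero`, but that declaration is private to its
  module and not importable here; our proof follows the same route.)
* `Complex.IsRMCandidate U z₀ f` — membership in Conway's family `𝓕` (without the harmless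
  normalisation `f'(z₀) > 0`, and recording `f' ≠ 0` on `U`), `Complex.exists_isRMCandidate_max`
  (an extremal element exists: Montel `Complex.exists_strictMono_tendstoLocallyUniformlyOn_of_norm_le`
  + Hurwitz + maximum modulus) and `Complex.IsRMCandidate.surjOn_of_max` (an extremal element is
  onto: the square-root trick, Conway VII.4.3 (4.6)).
* `Complex.HasSqrt U` — the square-root property (every zero-free holomorphic function on `U` has
  a holomorphic square root), the actual hypothesis of Conway's Lemma VII.4.3; simply connected open
  sets have it (`IsSimplyConnected.hasSqrt`). All of steps 1–3 are carried out under this weaker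
  hypothesis (plus connectedness), giving `Complex.exists_bijOn_ball_of_hasSqrt` (Conway VII.4.3
  verbatim), from which Conway VIII.2.2 deduces that such sets are simply connected.
* `Complex.exists_bijOn_ball_of_isSimplyConnected` — the Riemann mapping theorem.

As in `Literature/Analysis/Complex/Hurwitz.lean` and `Montel.lean`, declarations live in the
`Complex` namespace deliberately.

## References

* J. B. Conway, *Functions of one complex variable I*, GTM 11, 2nd ed. (1978), Ch. IV Cor. 7.6,
  Ch. VI Prop. 2.2, Ch. VII Cor. 2.6, Thm. 2.9, Thm. 4.2, Lemma 4.3.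
* L. V. Ahlfors, *Complex Analysis*, 3rd ed. (1979), Ch. 6 §1.1, Thm. 1.
-/

noncomputable section

open Filter Metric Set Topology Function
open scoped ComplexConjugate

namespace Complex

variable {U : Set ℂ}

/-! ### Disc automorphisms -/

/-- The **Möbius map** `φ_a(z) = (z - a) / (1 - conj a · z)`; for `‖a‖ < 1` it is a holomorphic
automorphism of the unit disc with `φ_a(a) = 0` and inverse `φ_{-a}` (Conway VI.2.2). The
definition is total: where `1 - conj a · z = 0` (possible only if `‖a‖ ‖z‖ ≥ 1`) it returns the
junk value `0` of division by zero; every lemma below assumes `‖a‖ < 1` and `‖z‖ ≤ 1`. [cite: Conway1978, Ch. VI Prop. 2.2] -/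
def discMobius (a z : ℂ) : ℂ :=
  (z - a) / (1 - conj a * z)

/-- Unfolding lemma for `Complex.discMobius`. [folklore] -/
theorem discMobius_apply (a z : ℂ) : discMobius a z = (z - a) / (1 - conj a * z) := rfl

/-- `φ_a(a) = 0` (Conway VI.2.2). [cite: Conway1978, Ch. VI Prop. 2.2] -/
@[simp] theorem discMobius_self (a : ℂ) : discMobius a a = 0 := by
  simp [discMobius]

/-- `φ_a(0) = -a` (Conway VI.2.2). [cite: Conway1978, Ch. VI Prop. 2.2] -/
@[simp] theorem discMobius_zero (a : ℂ) : discMobius a 0 = -a := by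
  simp [discMobius]

/-- The denominator `1 - conj a · z` of `φ_a` does not vanish for `‖a‖ < 1`, `‖z‖ ≤ 1`. [folklore] -/
theorem one_sub_conj_mul_ne_zero {a z : ℂ} (ha : ‖a‖ < 1) (hz : ‖z‖ ≤ 1) :
    1 - conj a * z ≠ 0 := by
  intro h
  have h1 : ‖conj a * z‖ = 1 := by
    rw [sub_eq_zero] at h
    rw [← h, norm_one]
  rw [norm_mul, norm_conj] at h1
  nlinarith [norm_nonneg a, norm_nonneg z]

/-- The key identity `|1 - conj a · z|² - |z - a|² = (1 - |a|²)(1 - |z|²)` behind `φ_a(𝔻) ⊆ 𝔻`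
(Conway VI.2.2, proof). [cite: Conway1978, Ch. VI Prop. 2.2] -/
theorem norm_sq_one_sub_conj_mul_sub (a z : ℂ) :
    ‖1 - conj a * z‖ ^ 2 - ‖z - a‖ ^ 2 = (1 - ‖a‖ ^ 2) * (1 - ‖z‖ ^ 2) := by
  simp only [← normSq_eq_norm_sq, normSq_apply, sub_re, sub_im, mul_re, mul_im, one_re, one_im,
    conj_re, conj_im]
  ring

/-- `φ_a` maps the open unit disc into itself when `‖a‖ < 1` (Conway VI.2.2). [cite: Conway1978, Ch. VI Prop. 2.2] -/
theorem norm_discMobius_lt_one {a z : ℂ} (ha : ‖a‖ < 1) (hz : ‖z‖ < 1) :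
    ‖discMobius a z‖ < 1 := by
  have hden : 0 < ‖1 - conj a * z‖ := norm_pos_iff.2 (one_sub_conj_mul_ne_zero ha hz.le)
  rw [discMobius, norm_div, div_lt_one hden, ← sq_lt_sq₀ (norm_nonneg _) (norm_nonneg _)]
  have key := norm_sq_one_sub_conj_mul_sub a z
  have ha2 : ‖a‖ ^ 2 < 1 := by nlinarith [norm_nonneg a]
  have hz2 : ‖z‖ ^ 2 < 1 := by nlinarith [norm_nonneg z]
  nlinarith [mul_pos (sub_pos.2 ha2) (sub_pos.2 hz2)]

/-- `φ_a` maps the open unit disc into itself when `‖a‖ < 1`, as a `MapsTo` statement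
(Conway VI.2.2). [cite: Conway1978, Ch. VI Prop. 2.2] -/
theorem mapsTo_discMobius {a : ℂ} (ha : ‖a‖ < 1) : MapsTo (discMobius a) (ball 0 1) (ball 0 1) :=
  fun _ hz ↦ mem_ball_zero_iff.2 (norm_discMobius_lt_one ha (mem_ball_zero_iff.1 hz))

/-- `φ_a(z) = 0` iff `z = a` (on the closed disc, `‖a‖ < 1`). [folklore] -/
theorem discMobius_eq_zero_iff {a z : ℂ} (ha : ‖a‖ < 1) (hz : ‖z‖ ≤ 1) :
    discMobius a z = 0 ↔ z = a := by
  rw [discMobius, div_eq_zero_iff, sub_eq_zero, or_iff_left (one_sub_conj_mul_ne_zero ha hz)]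

/-- The derivative of `φ_a`: `φ_a'(z) = (1 - |a|²) / (1 - conj a · z)²` wherever the denominator
is non-zero (Conway VI.2.2). [cite: Conway1978, Ch. VI Prop. 2.2] -/
theorem hasDerivAt_discMobius {a z : ℂ} (hz : 1 - conj a * z ≠ 0) :
    HasDerivAt (discMobius a) ((1 - conj a * a) / (1 - conj a * z) ^ 2) z := by
  have h1 : HasDerivAt (fun z : ℂ ↦ z - a) 1 z := (hasDerivAt_id z).sub_const a
  have h2 : HasDerivAt (fun z : ℂ ↦ 1 - conj a * z) (-conj a) z := by
    simpa using ((hasDerivAt_id z).const_mul (conj a)).const_sub 1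
  have h3 := h1.div h2 hz
  have hfun : discMobius a = fun y ↦ (y - a) / (1 - conj a * y) := rfl
  rw [hfun]
  refine h3.congr_deriv ?_
  ring

/-- `φ_a` is complex differentiable at every point of the closed unit disc (`‖a‖ < 1`). [folklore] -/
theorem differentiableAt_discMobius {a z : ℂ} (ha : ‖a‖ < 1) (hz : ‖z‖ ≤ 1) :
    DifferentiableAt ℂ (discMobius a) z :=
  (hasDerivAt_discMobius (one_sub_conj_mul_ne_zero ha hz)).differentiableAt

/-- `φ_a` is holomorphic on the open unit disc (`‖a‖ < 1`) (Conway VI.2.2). [cite: Conway1978, Ch. VI Prop. 2.2] -/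
theorem differentiableOn_discMobius {a : ℂ} (ha : ‖a‖ < 1) :
    DifferentiableOn ℂ (discMobius a) (ball 0 1) := fun _ hz ↦
  (differentiableAt_discMobius ha (mem_ball_zero_iff.1 hz).le).differentiableWithinAt

/-- The value `φ_a'(a) = 1 / (1 - |a|²)` (Conway VI.2.2). [cite: Conway1978, Ch. VI Prop. 2.2] -/
theorem deriv_discMobius_self {a : ℂ} (ha : ‖a‖ < 1) :
    deriv (discMobius a) a = 1 / (1 - conj a * a) := by
  have hne : 1 - conj a * a ≠ 0 := one_sub_conj_mul_ne_zero ha ha.le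
  rw [(hasDerivAt_discMobius hne).deriv]
  field_simp

/-- The value `φ_a'(0) = 1 - |a|²` (Conway VI.2.2). [cite: Conway1978, Ch. VI Prop. 2.2] -/
theorem deriv_discMobius_zero (a : ℂ) : deriv (discMobius a) 0 = 1 - conj a * a := by
  rw [(hasDerivAt_discMobius (z := 0) (by simp)).deriv]
  simp

/-- The derivative of `φ_a` does not vanish on the closed disc (`‖a‖ < 1`). [folklore] -/
theorem deriv_discMobius_ne_zero {a z : ℂ} (ha : ‖a‖ < 1) (hz : ‖z‖ ≤ 1) :
    deriv (discMobius a) z ≠ 0 := by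
  rw [(hasDerivAt_discMobius (one_sub_conj_mul_ne_zero ha hz)).deriv]
  exact div_ne_zero (one_sub_conj_mul_ne_zero ha ha.le)
    (pow_ne_zero _ (one_sub_conj_mul_ne_zero ha hz))

/-- `1 - conj a · a = 1 - |a|²`, as a real number cast. [folklore] -/
theorem one_sub_conj_mul_self (a : ℂ) : 1 - conj a * a = ((1 - ‖a‖ ^ 2 : ℝ) : ℂ) := by
  rw [conj_mul']
  push_cast
  ring

/-- `‖1 - conj a · a‖ = 1 - ‖a‖²` for `‖a‖ < 1`. [folklore] -/
theorem norm_one_sub_conj_mul_self {a : ℂ} (ha : ‖a‖ < 1) : ‖1 - conj a * a‖ = 1 - ‖a‖ ^ 2 := by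
  rw [one_sub_conj_mul_self, Complex.norm_real, Real.norm_of_nonneg]
  nlinarith [norm_nonneg a]

/-- `φ_{-a} ∘ φ_a = id` on the closed unit disc (`‖a‖ < 1`): `φ_{-a}` is the inverse of `φ_a`
(Conway VI.2.2). [cite: Conway1978, Ch. VI Prop. 2.2] -/
theorem discMobius_neg_discMobius {a z : ℂ} (ha : ‖a‖ < 1) (hz : ‖z‖ ≤ 1) :
    discMobius (-a) (discMobius a z) = z := by
  have hD : 1 - conj a * z ≠ 0 := one_sub_conj_mul_ne_zero ha hz
  have h1 : 1 - conj a * a ≠ 0 := one_sub_conj_mul_ne_zero ha ha.le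
  have hw : 1 + conj a * discMobius a z = (1 - conj a * a) / (1 - conj a * z) := by
    rw [discMobius]
    field_simp
    ring
  have hne : 1 + conj a * discMobius a z ≠ 0 := by
    rw [hw]
    exact div_ne_zero h1 hD
  have hrw : discMobius (-a) (discMobius a z) =
      (discMobius a z + a) / (1 + conj a * discMobius a z) := by
    rw [discMobius_apply (-a)]
    simp only [map_neg, neg_mul, sub_neg_eq_add]
  rw [hrw, hw, div_div_eq_mul_div, div_eq_iff h1, discMobius, div_add' _ _ _ hD,
    div_mul_cancel₀ _ hD]
  ring

/-- `φ_a` is injective on the open unit disc (`‖a‖ < 1`) (Conway VI.2.2). [cite: Conway1978, Ch. VI Prop. 2.2] -/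
theorem injOn_discMobius {a : ℂ} (ha : ‖a‖ < 1) : InjOn (discMobius a) (ball 0 1) := by
  intro x hx y hy h
  rw [← discMobius_neg_discMobius ha (mem_ball_zero_iff.1 hx).le,
    ← discMobius_neg_discMobius ha (mem_ball_zero_iff.1 hy).le, h]

/-! ### Continuous square roots of holomorphic functions are holomorphic -/

/-- If `h` is continuous on an open set `U`, `ψ` is holomorphic on `U`, `h ^ 2 = ψ` on `U` and
`h z ≠ 0`, then `h` is complex differentiable at `z ∈ U` with `h'(z) = ψ'(z) / (2 h(z))`.
(Locally `h = S ∘ ψ` for the local inverse `S` of `u ↦ u²` at `h z`, by the inverse function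
theorem.) This upgrades the continuous square roots of Mathlib's `Complex.exists_continuousOn_pow_eq`
to holomorphic ones (Conway VII.4.3 uses "analytic square roots"). [cite: Conway1978, Ch. VII Lemma 4.3 (proof)] -/
theorem hasDerivAt_of_sq_eq (hU : IsOpen U) {h ψ : ℂ → ℂ} (hh : ContinuousOn h U)
    (hψ : DifferentiableOn ℂ ψ U) (hsq : ∀ z ∈ U, h z ^ 2 = ψ z) {z : ℂ} (hz : z ∈ U)
    (hz0 : h z ≠ 0) : HasDerivAt h (deriv ψ z / (2 * h z)) z := by
  set v := h z with hv
  have h2v : (2 : ℂ) * v ≠ 0 := mul_ne_zero two_ne_zero hz0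
  have hsqd : HasStrictDerivAt (fun u : ℂ ↦ u ^ 2) (2 * v) v := by
    simpa using hasStrictDerivAt_pow 2 v
  -- the local inverse `S` of squaring near `v`
  have hleft := hsqd.eventually_left_inverse h2v
  have hS := (hsqd.to_localInverse h2v).hasDerivAt
  set S := hsqd.localInverse (fun u : ℂ ↦ u ^ 2) (2 * v) v h2v with hSdef
  -- `h = S ∘ ψ` near `z`
  have hcont : ContinuousAt h z := hh.continuousAt (hU.mem_nhds hz)
  have hev : h =ᶠ[𝓝 z] S ∘ ψ := by
    have h1 : ∀ᶠ y in 𝓝 z, S (h y ^ 2) = h y := hcont.eventually hleft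
    filter_upwards [h1, hU.mem_nhds hz] with y hy hyU
    rw [comp_apply, ← hsq y hyU, hy]
  have hψz : ψ z = v ^ 2 := (hsq z hz).symm
  have hS' : HasDerivAt S (2 * v)⁻¹ (ψ z) := by rwa [hψz]
  have hcomp : HasDerivAt (S ∘ ψ) ((2 * v)⁻¹ * deriv ψ z) z :=
    hS'.comp z (hψ.hasDerivAt (hU.mem_nhds hz))
  have := hcomp.congr_of_eventuallyEq hev
  rwa [div_eq_inv_mul]

/-- A continuous square root `h` of a holomorphic zero-free function `ψ` on an open set `U` is
holomorphic on `U`. [cite: Conway1978, Ch. VII Lemma 4.3 (proof)] -/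
theorem differentiableOn_of_sq_eq (hU : IsOpen U) {h ψ : ℂ → ℂ} (hh : ContinuousOn h U)
    (hψ : DifferentiableOn ℂ ψ U) (hsq : ∀ z ∈ U, h z ^ 2 = ψ z) (h0 : ∀ z ∈ U, h z ≠ 0) :
    DifferentiableOn ℂ h U := fun z hz ↦
  (hasDerivAt_of_sq_eq hU hh hψ hsq hz (h0 z hz)).differentiableAt.differentiableWithinAt

/-- The derivative of a continuous square root `h` of a holomorphic function `ψ`:
`h' z = ψ' z / (2 h z)` at points where `h z ≠ 0`. [cite: Conway1978, Ch. VII Lemma 4.3 (proof)] -/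
theorem deriv_of_sq_eq (hU : IsOpen U) {h ψ : ℂ → ℂ} (hh : ContinuousOn h U)
    (hψ : DifferentiableOn ℂ ψ U) (hsq : ∀ z ∈ U, h z ^ 2 = ψ z) {z : ℂ} (hz : z ∈ U)
    (hz0 : h z ≠ 0) : deriv h z = deriv ψ z / (2 * h z) :=
  (hasDerivAt_of_sq_eq hU hh hψ hsq hz hz0).deriv

/-! ### The square-root property -/

/-- The **square-root property** of a set `U ⊆ ℂ`, the hypothesis of Conway's Lemma VII.4.3
(and condition (h) in the list of equivalents of simple connectivity, Conway VIII.2.2): every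
zero-free holomorphic function `g` on `U` has a holomorphic square root `h` on `U`, `h² = g` on
`U`. Open simply connected sets have it (`IsSimplyConnected.hasSqrt`); conversely (Conway VIII.2.2,
via the Riemann mapping theorem in the form `Complex.exists_bijOn_ball_of_hasSqrt` below) a
connected open set with the square-root property is simply connected. Conway, *Functions of One
Complex Variable I* (1978), Ch. VII Lemma 4.3 (hypothesis). [cite: Conway1978, Ch. VII Lemma 4.3] -/
def HasSqrt (U : Set ℂ) : Prop :=
  ∀ g : ℂ → ℂ, DifferentiableOn ℂ g U → (∀ z ∈ U, g z ≠ 0) →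
    ∃ h : ℂ → ℂ, DifferentiableOn ℂ h U ∧ ∀ z ∈ U, h z ^ 2 = g z

/-- Unfolding lemma for `Complex.HasSqrt`. [folklore] -/
theorem hasSqrt_iff : HasSqrt U ↔ ∀ g : ℂ → ℂ, DifferentiableOn ℂ g U → (∀ z ∈ U, g z ≠ 0) →
    ∃ h : ℂ → ℂ, DifferentiableOn ℂ h U ∧ ∀ z ∈ U, h z ^ 2 = g z := Iff.rfl

/-- A holomorphic square root on `U` can be modified off `U` so that `h² = g` holds
**everywhere** (off `U` use the principal branch `g ^ (1/2)`), which is convenient below.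
[folklore] -/
theorem HasSqrt.exists_forall_sq_eq (hsq : HasSqrt U) {g : ℂ → ℂ} (hg : DifferentiableOn ℂ g U)
    (hg0 : ∀ z ∈ U, g z ≠ 0) :
    ∃ h : ℂ → ℂ, DifferentiableOn ℂ h U ∧ ∀ z, h z ^ 2 = g z := by
  classical
  obtain ⟨h, hhd, hh⟩ := hsq g hg hg0
  refine ⟨U.piecewise h (fun z ↦ g z ^ (1 / 2 : ℂ)), ?_, fun z ↦ ?_⟩
  · exact hhd.congr fun z hz ↦ piecewise_eq_of_mem _ _ _ hz
  · by_cases hz : z ∈ U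
    · rw [piecewise_eq_of_mem _ _ _ hz, hh z hz]
    · rw [piecewise_eq_of_notMem _ _ _ hz, ← cpow_nat_mul]
      norm_num

/-- **Open simply connected sets have the square-root property**: Mathlib's continuous square
roots on simply connected open sets (`Complex.exists_continuousOn_pow_eq`, a covering-space
argument) are holomorphic (`Complex.differentiableOn_of_sq_eq`). Conway (1978), Cor. IV.6.17.
[cite: Conway1978, Ch. IV Cor. 6.17] -/
theorem _root_.IsSimplyConnected.hasSqrt (hsc : IsSimplyConnected U) (hU : IsOpen U) :
    HasSqrt U := by
  intro g hg hg0
  obtain ⟨h, hhc, hh⟩ := exists_continuousOn_pow_eq hsc hU hg.continuousOn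
    (by rintro ⟨z, hz, h0⟩; exact hg0 z hz h0) two_ne_zero
  have hh0 : ∀ z ∈ U, h z ≠ 0 := fun z hz h0 ↦ hg0 z hz (by
    rw [← hh z, h0]
    norm_num)
  exact ⟨h, differentiableOn_of_sq_eq hU hhc hg (fun z _ ↦ hh z) hh0, fun z _ ↦ hh z⟩

/-! ### Holomorphic inverses -/

/-- A holomorphic function on an open set has a strict derivative at each of its points. [folklore] -/
theorem hasStrictDerivAt_of_differentiableOn (hU : IsOpen U) {f : ℂ → ℂ}
    (hf : DifferentiableOn ℂ f U) {a : ℂ} (ha : a ∈ U) : HasStrictDerivAt f (deriv f a) a :=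
  ((hf.contDiffOn (n := 1) hU).contDiffAt (hU.mem_nhds ha)).hasStrictDerivAt one_ne_zero

/-- A holomorphic map with zero-free derivative on an open set `U` maps neighbourhoods in `U` onto
neighbourhoods: `f '' U ∈ 𝓝 (f a)` for `a ∈ U` (inverse function theorem). [folklore] -/
theorem image_mem_nhds_of_deriv_ne_zero (hU : IsOpen U) {f : ℂ → ℂ} (hf : DifferentiableOn ℂ f U)
    {a : ℂ} (ha : a ∈ U) (hf' : deriv f a ≠ 0) : f '' U ∈ 𝓝 (f a) := by
  rw [← (hasStrictDerivAt_of_differentiableOn hU hf ha).map_nhds_eq hf']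
  exact image_mem_map (hU.mem_nhds ha)

/-- The image of an open set under a holomorphic map with zero-free derivative is open. [folklore] -/
theorem isOpen_image_of_deriv_ne_zero (hU : IsOpen U) {f : ℂ → ℂ} (hf : DifferentiableOn ℂ f U)
    (hf' : ∀ z ∈ U, deriv f z ≠ 0) : IsOpen (f '' U) := by
  refine isOpen_iff_mem_nhds.2 ?_
  rintro _ ⟨a, ha, rfl⟩
  exact image_mem_nhds_of_deriv_ne_zero hU hf ha (hf' a ha)

/-- **Holomorphic inverse** (Conway IV.7.6): if `f` is holomorphic and injective on an open set `U`
with zero-free derivative, then the inverse `Function.invFunOn f U` has strict derivative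
`(f' a)⁻¹` at `f a`, for every `a ∈ U`. [cite: Conway1978, Ch. IV Cor. 7.6] -/
theorem hasStrictDerivAt_invFunOn (hU : IsOpen U) {f : ℂ → ℂ} (hf : DifferentiableOn ℂ f U)
    (hinj : InjOn f U) (hf' : ∀ z ∈ U, deriv f z ≠ 0) {a : ℂ} (ha : a ∈ U) :
    HasStrictDerivAt (invFunOn f U) (deriv f a)⁻¹ (f a) := by
  set g := invFunOn f U with hg
  have hga : g (f a) = a := hinj.leftInvOn_invFunOn ha
  have hfa : HasStrictDerivAt f (deriv f a) a := hasStrictDerivAt_of_differentiableOn hU hf ha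
  have hmap : map f (𝓝 a) = 𝓝 (f a) := hfa.map_nhds_eq (hf' a ha)
  -- continuity of the inverse at `f a`
  have hcont : ContinuousAt g (f a) := by
    have h1 : Tendsto (g ∘ f) (𝓝 a) (𝓝 a) := tendsto_id.congr' <| by
      filter_upwards [hU.mem_nhds ha] with x hx using (hinj.leftInvOn_invFunOn hx).symm
    rw [ContinuousAt, hga, ← hmap, tendsto_map'_iff]
    exact h1
  -- `f ∘ g = id` near `f a`
  have hfg : ∀ᶠ y in 𝓝 (f a), f (g y) = y := by
    filter_upwards [image_mem_nhds_of_deriv_ne_zero hU hf ha (hf' a ha)] with y hy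
    exact invFunOn_eq hy
  refine HasStrictDerivAt.of_local_left_inverse hcont ?_ (hf' a ha) hfg
  rwa [hga]

/-- **Holomorphic inverse** (Conway IV.7.6): the inverse `Function.invFunOn f U` of an injective
holomorphic map with zero-free derivative on an open set `U` is holomorphic on the image `f '' U`.
[cite: Conway1978, Ch. IV Cor. 7.6] -/
theorem differentiableOn_invFunOn_image (hU : IsOpen U) {f : ℂ → ℂ} (hf : DifferentiableOn ℂ f U)
    (hinj : InjOn f U) (hf' : ∀ z ∈ U, deriv f z ≠ 0) :
    DifferentiableOn ℂ (invFunOn f U) (f '' U) := by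
  rintro _ ⟨a, ha, rfl⟩
  exact (hasStrictDerivAt_invFunOn hU hf hinj hf' ha).hasDerivAt.differentiableAt
    |>.differentiableWithinAt

/-! ### Hurwitz: limits of injective holomorphic functions -/

/-- **Hurwitz's theorem for univalent functions** (Conway VII.4.3, proof of (4.5); a corollary of
`Complex.hurwitz_eqOn_zero_or_forall_ne_zero`, Conway VII.2.5–2.6): on an open preconnected set
`U`, a locally uniform limit `f` of holomorphic functions `F n` that are injective on `U` is either
constant on `U` or injective on `U`. [cite: Conway1978, Ch. VII Lemma 4.3 (proof of (4.5))] -/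
theorem exists_eqOn_const_or_injOn_of_tendstoLocallyUniformlyOn {ι : Type*} {l : Filter ι}
    [l.NeBot] (hU : IsOpen U) (hUc : IsPreconnected U) {F : ι → ℂ → ℂ} {f : ℂ → ℂ}
    (hF : ∀ᶠ n in l, DifferentiableOn ℂ (F n) U) (hinj : ∀ᶠ n in l, InjOn (F n) U)
    (hlim : TendstoLocallyUniformlyOn F f l U) :
    (∃ c, EqOn f (const ℂ c) U) ∨ InjOn f U := by
  classical
  by_contra hcon
  push Not at hcon
  obtain ⟨hnc, hninj⟩ := hcon
  obtain ⟨a, ha, b, hb, hab, hne⟩ : ∃ a ∈ U, ∃ b ∈ U, f a = f b ∧ a ≠ b := by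
    simp only [InjOn, not_forall] at hninj
    obtain ⟨a, ha, b, hb, hab, hne⟩ := hninj
    exact ⟨a, ha, b, hb, hab, hne⟩
  have hfd : DifferentiableOn ℂ f U := hlim.differentiableOn hF hU
  -- a small disc `V` around `a`, inside `U`, not containing `b`
  obtain ⟨r₀, hr₀, hr₀U⟩ := Metric.isOpen_iff.1 hU a ha
  set r := min r₀ (dist b a) with hr
  have hrpos : 0 < r := lt_min hr₀ (dist_pos.2 hne.symm)
  set V := ball a r with hV
  have hVU : V ⊆ U := (ball_subset_ball (min_le_left _ _)).trans hr₀U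
  have hbV : b ∉ V := fun h ↦ by
    have := mem_ball.1 h
    linarith [min_le_right r₀ (dist b a)]
  -- `F n - F n b → f - f b` locally uniformly on `V`, zero-free on `V`
  have hlimV : TendstoLocallyUniformlyOn (fun n z ↦ F n z - F n b) (fun z ↦ f z - f b) l V := by
    have h1 := (hlim.mono hVU).sub
      ((hlim.tendsto_at hb).tendstoUniformlyOn_const V).tendstoLocallyUniformlyOn
    exact h1
  have hFV : ∀ᶠ n in l, DifferentiableOn ℂ (fun z ↦ F n z - F n b) V :=
    hF.mono fun n hn ↦ (hn.mono hVU).sub_const _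
  have h0 : ∃ᶠ n in l, ∀ z ∈ V, F n z - F n b ≠ 0 := by
    refine (hinj.mono fun n hn z hz h0 ↦ hbV ?_).frequently
    rwa [← hn (hVU hz) hb (sub_eq_zero.1 h0)]
  rcases hurwitz_eqOn_zero_or_forall_ne_zero isOpen_ball (convex_ball a r).isPreconnected hFV
    hlimV h0 with h | h
  · have hev : f =ᶠ[𝓝 a] fun _ ↦ f b := by
      filter_upwards [isOpen_ball.mem_nhds (mem_ball_self hrpos)] with z hz
        using sub_eq_zero.1 (h hz)
    exact hnc (f b) ((hfd.analyticOnNhd hU).eqOn_of_preconnected_of_eventuallyEq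
      analyticOnNhd_const hUc ha hev)
  · exact h a (mem_ball_self hrpos) (by rw [hab, sub_self])

/-! ### Riemann mapping theorem, steps 1–2: into the disc -/

/-- **Riemann mapping theorem, steps 1–2** (Conway VII.4.3, proof of (4.4); Koebe): if `U ⊊ ℂ`
is open, nonempty and has the square-root property (e.g. `U` simply connected), there is a
holomorphic map `f : U → 𝔻`, injective on `U`, with zero-free derivative on `U`. (Take `a ∉ U`
and a holomorphic branch `h` of `√(z - a)` on `U`; `h` is injective and `h(U)` misses the open set
`-h(U)`, so some disc `B(x, ε)` misses `h(U)`; then `f = ε / (2 (h - x))` works.) Mathlib proves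
the simply connected case in `Mathlib/Analysis/Complex/RiemannMapping.lean`
(`Complex.exists_mapsTo_unitBall_injOn_deriv_ne_zero`, not exported from that module at present);
the proof below follows the same route. [cite: Conway1978, Ch. VII Lemma 4.3 (proof of (4.4))] -/
theorem exists_mapsTo_ball_injOn_deriv_ne_zero (hU : IsOpen U) (hne : U.Nonempty) (hsq : HasSqrt U)
    (hU' : U ≠ univ) :
    ∃ f : ℂ → ℂ, DifferentiableOn ℂ f U ∧ MapsTo f U (ball 0 1) ∧ InjOn f U ∧
      ∀ z ∈ U, deriv f z ≠ 0 := by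
  classical
  obtain ⟨a, ha⟩ := (ne_univ_iff_exists_notMem U).1 hU'
  -- a holomorphic branch `h` of `√(z - a)` on `U`
  have h0 : ∀ z ∈ U, z - a ≠ 0 := fun z hz hza ↦ ha (by rwa [sub_eq_zero.1 hza] at hz)
  obtain ⟨h, hhd', hh⟩ := hsq.exists_forall_sq_eq (differentiableOn_id.sub_const a) h0
  have hhc : ContinuousOn h U := hhd'.continuousOn
  have hh0 : ∀ z ∈ U, h z ≠ 0 := by
    intro z hz hz0
    have h1 := hh z
    rw [hz0, zero_pow two_ne_zero, eq_comm, sub_eq_zero] at h1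
    exact ha (h1 ▸ hz)
  have hψ : DifferentiableOn ℂ (fun z ↦ z - a) U := differentiableOn_id.sub_const a
  have hhd : DifferentiableOn ℂ h U := differentiableOn_of_sq_eq hU hhc hψ (fun z _ ↦ hh z) hh0
  have hderiv : ∀ z ∈ U, deriv h z = 1 / (2 * h z) := fun z hz ↦ by
    rw [deriv_of_sq_eq hU hhc hψ (fun z _ ↦ hh z) hz (hh0 z hz), deriv_sub_const, deriv_id'']
  have hd0 : ∀ z ∈ U, deriv h z ≠ 0 := fun z hz ↦ by
    rw [hderiv z hz]
    exact div_ne_zero one_ne_zero (mul_ne_zero two_ne_zero (hh0 z hz))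
  have hinj : Injective h := fun x y hxy ↦ by
    have h1 := hh x
    rw [hxy, hh y] at h1
    exact sub_left_injective h1.symm
  -- `h(U)` misses a disc around `-h x₀`
  obtain ⟨x₀, hx₀⟩ := hne
  obtain ⟨ε, hε, hεU⟩ := Metric.mem_nhds_iff.1
    (image_mem_nhds_of_deriv_ne_zero hU hhd hx₀ (hd0 x₀ hx₀))
  set x : ℂ := -h x₀ with hx
  have hfar : ∀ b ∈ U, ε ≤ dist (h b) x := by
    intro b hb
    by_contra hlt
    push Not at hlt
    have hmem : -h b ∈ ball (h x₀) ε := by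
      rw [mem_ball, dist_eq_norm]
      rw [dist_eq_norm, hx] at hlt
      calc ‖-h b - h x₀‖ = ‖-(h b - -h x₀)‖ := by ring_nf
        _ < ε := by rwa [norm_neg]
    obtain ⟨c, hc, hcb⟩ := hεU hmem
    have hbc : c = b := by
      have h1 := hh c
      rw [hcb, neg_sq, hh b] at h1
      exact sub_left_injective h1.symm
    subst hbc
    exact hh0 c hc (by
      have h2 : (2 : ℂ) * h c = 0 := by rw [two_mul]; nth_rw 1 [hcb]; ring
      exact (mul_eq_zero.1 h2).resolve_left two_ne_zero)
  have hne : ∀ b ∈ U, h b - x ≠ 0 := fun b hb h0 ↦ by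
    have := hfar b hb
    rw [dist_eq_norm, h0, norm_zero] at this
    exact absurd this (not_le.2 hε)
  -- `f = ε / (2 (h - x))`
  refine ⟨fun z ↦ (ε / 2 : ℂ) * (h z - x)⁻¹, ?_, ?_, ?_, ?_⟩
  · exact (differentiableOn_const _).mul ((hhd.sub_const x).inv hne)
  · intro z hz
    rw [mem_ball_zero_iff, norm_mul, norm_inv, ← div_eq_mul_inv]
    have hε2 : ‖(ε / 2 : ℂ)‖ = ε / 2 := by
      rw [show (ε / 2 : ℂ) = ((ε / 2 : ℝ) : ℂ) by push_cast; ring, Complex.norm_real,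
        Real.norm_of_nonneg (by positivity)]
    rw [hε2, div_lt_one (norm_pos_iff.2 (hne z hz))]
    have := hfar z hz
    rw [dist_eq_norm] at this
    linarith
  · intro z hz w hw hzw
    have hε0 : (ε / 2 : ℂ) ≠ 0 := by
      exact_mod_cast (by positivity : (ε / 2 : ℝ) ≠ 0)
    have h1 : (h z - x)⁻¹ = (h w - x)⁻¹ := mul_left_cancel₀ hε0 hzw
    rw [inv_inj, sub_left_inj] at h1
    exact hinj h1
  · intro z hz
    have hε0 : (ε / 2 : ℂ) ≠ 0 := by
      exact_mod_cast (by positivity : (ε / 2 : ℝ) ≠ 0)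
    have hhz : HasDerivAt h (deriv h z) z :=
      (hhd.differentiableAt (hU.mem_nhds hz)).hasDerivAt
    have h1 : HasDerivAt (fun y ↦ (ε / 2 : ℂ) * (h y - x)⁻¹)
        ((ε / 2 : ℂ) * (-(deriv h z) / (h z - x) ^ 2)) z :=
      ((hhz.sub_const x).inv (hne z hz)).const_mul _
    rw [h1.deriv]
    exact mul_ne_zero hε0 (div_ne_zero (neg_ne_zero.2 (hd0 z hz)) (pow_ne_zero _ (hne z hz)))

/-! ### The extremal family -/

/-- Conway's family `𝓕` (VII.4.3) of candidates for the Riemann map of `U` based at `z₀`: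
holomorphic maps `f : U → 𝔻`, injective on `U`, with `f z₀ = 0`. We drop Conway's harmless
normalisation `f'(z₀) > 0` and instead record that `f'` is zero-free on `U` (automatic for
injective holomorphic maps, Conway IV.7.4–7.5, but cheaper to carry along than to derive; it is
what makes the inverse holomorphic, Conway IV.7.6). [cite: Conway1978, Ch. VII Lemma 4.3] -/
structure IsRMCandidate (U : Set ℂ) (z₀ : ℂ) (f : ℂ → ℂ) : Prop where
  /-- `f` is holomorphic on `U`. -/
  differentiableOn : DifferentiableOn ℂ f U
  /-- `f` maps `U` into the open unit disc. -/
  mapsTo : MapsTo f U (ball 0 1)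
  /-- `f` is injective on `U`. -/
  injOn : InjOn f U
  /-- `f z₀ = 0`. -/
  eq_zero : f z₀ = 0
  /-- `f'` does not vanish on `U`. -/
  deriv_ne_zero : ∀ z ∈ U, deriv f z ≠ 0

namespace IsRMCandidate

variable {z₀ : ℂ} {f : ℂ → ℂ}

/-- Members of `𝓕` are bounded by `1` in norm on `U`. [cite: Conway1978, Ch. VII Lemma 4.3] -/
theorem norm_lt_one (hf : IsRMCandidate U z₀ f) {z : ℂ} (hz : z ∈ U) : ‖f z‖ < 1 :=
  mem_ball_zero_iff.1 (hf.mapsTo hz)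

/-- Normalising at `z₀` (Conway VII.4.3): if `f : U → 𝔻` is holomorphic and injective on the open
set `U` with zero-free derivative and `z₀ ∈ U`, then `φ_{f z₀} ∘ f ∈ 𝓕`. [cite: Conway1978, Ch. VII Lemma 4.3 (proof)] -/
theorem discMobius_comp (hU : IsOpen U) (hd : DifferentiableOn ℂ f U)
    (hm : MapsTo f U (ball 0 1)) (hi : InjOn f U) (h0 : ∀ z ∈ U, deriv f z ≠ 0)
    (hz₀ : z₀ ∈ U) : IsRMCandidate U z₀ (discMobius (f z₀) ∘ f) where
  differentiableOn :=
    (differentiableOn_discMobius (mem_ball_zero_iff.1 (hm hz₀))).comp hd hm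
  mapsTo := (mapsTo_discMobius (mem_ball_zero_iff.1 (hm hz₀))).comp hm
  injOn := (injOn_discMobius (mem_ball_zero_iff.1 (hm hz₀))).comp hi hm
  eq_zero := by simp
  deriv_ne_zero := fun z hz ↦ by
    have ha : ‖f z₀‖ < 1 := mem_ball_zero_iff.1 (hm hz₀)
    have hfz : ‖f z‖ < 1 := mem_ball_zero_iff.1 (hm hz)
    rw [deriv_comp z (differentiableAt_discMobius ha hfz.le)
      (hd.differentiableAt (hU.mem_nhds hz))]
    exact mul_ne_zero (deriv_discMobius_ne_zero ha hfz.le) (h0 z hz)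

end IsRMCandidate

/-- The family `𝓕` is nonempty (Conway VII.4.3, (4.4)): steps 1–2 followed by the normalisation
`φ_{f z₀} ∘ f`. [cite: Conway1978, Ch. VII Lemma 4.3 ((4.4))] -/
theorem exists_isRMCandidate (hU : IsOpen U) (hsq : HasSqrt U) (hU' : U ≠ univ)
    {z₀ : ℂ} (hz₀ : z₀ ∈ U) : ∃ f, IsRMCandidate U z₀ f := by
  obtain ⟨f, hd, hm, hi, h0⟩ := exists_mapsTo_ball_injOn_deriv_ne_zero hU ⟨z₀, hz₀⟩ hsq hU'
  exact ⟨_, IsRMCandidate.discMobius_comp hU hd hm hi h0 hz₀⟩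

/-- The derivatives at `z₀` over the family `𝓕` are bounded (Cauchy's estimate on a closed disc
`closedBall z₀ r ⊆ U`; in Conway VII.4.3 this is Montel's theorem via Lemma VII.2.8). [cite: Conway1978, Ch. VII Lemma 4.3 (proof of (4.5))] -/
theorem exists_forall_isRMCandidate_norm_deriv_le (hU : IsOpen U) {z₀ : ℂ} (hz₀ : z₀ ∈ U) :
    ∃ B : ℝ, ∀ f, IsRMCandidate U z₀ f → ‖deriv f z₀‖ ≤ B := by
  obtain ⟨r, hr, hrU⟩ := nhds_basis_closedBall.mem_iff.1 (hU.mem_nhds hz₀)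
  refine ⟨1 / r, fun f hf ↦ ?_⟩
  exact norm_deriv_le_of_forall_mem_sphere_norm_le hr (hf.differentiableOn.diffContOnCl_ball hrU)
    fun z hz ↦ (hf.norm_lt_one (hrU (sphere_subset_closedBall hz))).le

/-- **Existence of an extremal candidate** (Conway VII.4.3, proof of (4.5)): for `U ⊊ ℂ` open and
connected with the square-root property and `z₀ ∈ U`, some `f ∈ 𝓕` maximises `‖f'(z₀)‖` over `𝓕`. Proof: a maximising
sequence is bounded by `1`, so by Montel's theorem
(`Complex.exists_strictMono_tendstoLocallyUniformlyOn_of_norm_le`) a subsequence converges locally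
uniformly, with derivatives, to a holomorphic `f` with `‖f'(z₀)‖ = sup > 0`; `f` is injective by
Hurwitz (`Complex.exists_eqOn_const_or_injOn_of_tendstoLocallyUniformlyOn`), `f'` is zero-free by
Hurwitz applied to the derivatives, and `f(U) ⊆ 𝔻` by the maximum modulus principle. [cite: Conway1978, Ch. VII Lemma 4.3 ((4.5))] -/
theorem exists_isRMCandidate_max (hU : IsOpen U) (hUc : IsPreconnected U) (hsq : HasSqrt U)
    (hU' : U ≠ univ) {z₀ : ℂ} (hz₀ : z₀ ∈ U) :
    ∃ f, IsRMCandidate U z₀ f ∧ ∀ g, IsRMCandidate U z₀ g → ‖deriv g z₀‖ ≤ ‖deriv f z₀‖ := by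
  classical
  set S : Set ℝ := (fun f : ℂ → ℂ ↦ ‖deriv f z₀‖) '' {f | IsRMCandidate U z₀ f} with hS
  obtain ⟨f₁, hf₁⟩ := exists_isRMCandidate hU hsq hU' hz₀
  have hSne : S.Nonempty := ⟨_, f₁, hf₁, rfl⟩
  obtain ⟨B, hB⟩ := exists_forall_isRMCandidate_norm_deriv_le hU hz₀
  have hSb : BddAbove S := ⟨B, by rintro _ ⟨g, hg, rfl⟩; exact hB g hg⟩
  set M := sSup S with hM
  have hleM : ∀ g, IsRMCandidate U z₀ g → ‖deriv g z₀‖ ≤ M := fun g hg ↦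
    le_csSup hSb ⟨g, hg, rfl⟩
  -- a maximising sequence
  have hseq : ∀ n : ℕ, ∃ g, IsRMCandidate U z₀ g ∧ M - 1 / ((n : ℝ) + 1) < ‖deriv g z₀‖ := by
    intro n
    have hlt : M - 1 / ((n : ℝ) + 1) < sSup S := by
      have : (0 : ℝ) < 1 / ((n : ℝ) + 1) := Nat.one_div_pos_of_nat
      linarith
    obtain ⟨_, ⟨g, hg, rfl⟩, hlt'⟩ := exists_lt_of_lt_csSup hSne hlt
    exact ⟨g, hg, hlt'⟩
  choose F hF hFM using hseq
  -- Montel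
  obtain ⟨f, φ, hφ, hfd, hlim, hlim'⟩ := exists_strictMono_tendstoLocallyUniformlyOn_of_norm_le
    (M := 1) hU (fun n ↦ (hF n).differentiableOn) (fun n z hz ↦ ((hF n).norm_lt_one hz).le)
  -- the derivative of the limit at `z₀` has norm `M > 0`
  have hnorm : ‖deriv f z₀‖ = M := by
    have h1 : Tendsto (fun n ↦ ‖deriv (F (φ n)) z₀‖) atTop (𝓝 ‖deriv f z₀‖) :=
      (hlim'.tendsto_at hz₀).norm
    have h2 : Tendsto (fun n ↦ ‖deriv (F (φ n)) z₀‖) atTop (𝓝 M) := by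
      have h3 : Tendsto (fun n : ℕ ↦ 1 / ((n : ℝ) + 1)) atTop (𝓝 0) :=
        tendsto_one_div_add_atTop_nhds_zero_nat
      have hlow : Tendsto (fun n : ℕ ↦ M - 1 / (((φ n : ℕ) : ℝ) + 1)) atTop (𝓝 M) := by
        simpa using tendsto_const_nhds.sub (h3.comp hφ.tendsto_atTop)
      exact tendsto_of_tendsto_of_tendsto_of_le_of_le hlow tendsto_const_nhds
        (fun n ↦ (hFM (φ n)).le) (fun n ↦ hleM _ (hF (φ n)))
    exact tendsto_nhds_unique h1 h2
  have hMpos : 0 < M :=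
    lt_of_lt_of_le (norm_pos_iff.2 (hf₁.deriv_ne_zero z₀ hz₀)) (hleM f₁ hf₁)
  have hd0 : deriv f z₀ ≠ 0 := norm_pos_iff.1 (hnorm ▸ hMpos)
  -- hence `f` is not constant on `U`
  have hnc : ∀ c, ¬ EqOn f (const ℂ c) U := by
    intro c hc
    apply hd0
    have h1 : f =ᶠ[𝓝 z₀] fun _ ↦ c := by
      filter_upwards [hU.mem_nhds hz₀] with z hz using hc hz
    rw [h1.deriv_eq, deriv_const]
  -- `f z₀ = 0`
  have hf0 : f z₀ = 0 := by
    have h1 : Tendsto (fun n ↦ F (φ n) z₀) atTop (𝓝 (f z₀)) := hlim.tendsto_at hz₀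
    have h2 : (fun n ↦ F (φ n) z₀) = fun _ ↦ 0 := funext fun n ↦ (hF (φ n)).eq_zero
    rw [h2] at h1
    exact tendsto_nhds_unique tendsto_const_nhds h1 |>.symm
  -- `f` is injective (Hurwitz)
  have hinj : InjOn f U := by
    rcases exists_eqOn_const_or_injOn_of_tendstoLocallyUniformlyOn hU hUc
      (Eventually.of_forall fun n ↦ (hF (φ n)).differentiableOn)
      (Eventually.of_forall fun n ↦ (hF (φ n)).injOn) hlim with ⟨c, hc⟩ | h
    · exact absurd hc (hnc c)
    · exact h
  -- `f'` is zero-free (Hurwitz applied to the derivatives)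
  have hd : ∀ z ∈ U, deriv f z ≠ 0 := by
    rcases hurwitz_eqOn_zero_or_forall_ne_zero hU hUc
      (Eventually.of_forall fun n ↦
        ((hF (φ n)).differentiableOn.analyticOnNhd hU).deriv.differentiableOn) hlim'
      (Frequently.of_forall fun n ↦ (hF (φ n)).deriv_ne_zero) with h | h
    · exact absurd (h hz₀) hd0
    · exact h
  -- `f` maps into the closed disc, hence (maximum modulus) into the open disc
  have hle1 : ∀ z ∈ U, ‖f z‖ ≤ 1 := fun z hz ↦
    le_of_tendsto (hlim.tendsto_at hz).norm
      (Eventually.of_forall fun n ↦ ((hF (φ n)).norm_lt_one hz).le)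
  have hmaps : MapsTo f U (ball 0 1) := by
    intro z hz
    rw [mem_ball_zero_iff]
    rcases (hle1 z hz).lt_or_eq with h | h
    · exact h
    · exfalso
      have hmax : IsMaxOn (norm ∘ f) U z := fun w hw ↦ by
        simpa [h] using hle1 w hw
      exact hnc (f z) (eqOn_of_isPreconnected_of_isMaxOn_norm hUc hU hfd hz hmax)
  refine ⟨f, ⟨hfd, hmaps, hinj, hf0, hd⟩, fun g hg ↦ ?_⟩
  rw [hnorm]
  exact hleM g hg

/-- **An extremal candidate is onto the disc** (Conway VII.4.3, proof of (4.6); Koebe's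
square-root trick). If `f ∈ 𝓕` maximises `‖f'(z₀)‖` over `𝓕`, then `f(U) = 𝔻`: were `w ∈ 𝔻`
omitted, `φ_w ∘ f` would be zero-free on `U`, so (square-root property) it has a holomorphic
square root `h`, and `g = φ_{h(z₀)} ∘ h ∈ 𝓕` has `‖g'(z₀)‖ = ‖f'(z₀)‖ (1 + |w|) / (2 √|w|) > ‖f'(z₀)‖`.
[cite: Conway1978, Ch. VII Lemma 4.3 ((4.6))] -/
theorem IsRMCandidate.surjOn_of_forall_le (hU : IsOpen U) (hsq : HasSqrt U) {z₀ : ℂ}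
    (hz₀ : z₀ ∈ U) {f : ℂ → ℂ} (hf : IsRMCandidate U z₀ f)
    (hmax : ∀ g, IsRMCandidate U z₀ g → ‖deriv g z₀‖ ≤ ‖deriv f z₀‖) :
    SurjOn f U (ball 0 1) := by
  intro w hw
  by_contra hwU
  have hw1 : ‖w‖ < 1 := mem_ball_zero_iff.1 hw
  -- `ψ := φ_w ∘ f` is zero-free on `U`
  set ψ := discMobius w ∘ f with hψ
  have hψd : DifferentiableOn ℂ ψ U :=
    (differentiableOn_discMobius hw1).comp hf.differentiableOn hf.mapsTo
  have hψ0 : ∀ z ∈ U, ψ z ≠ 0 := fun z hz h0 ↦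
    hwU ⟨z, hz, (discMobius_eq_zero_iff hw1 (hf.norm_lt_one hz).le).1 h0⟩
  have hψ1 : ∀ z ∈ U, ‖ψ z‖ < 1 := fun z hz ↦ norm_discMobius_lt_one hw1 (hf.norm_lt_one hz)
  -- a holomorphic square root `h` of `ψ`
  obtain ⟨h, hhd', hh⟩ := hsq.exists_forall_sq_eq hψd hψ0
  have hhc : ContinuousOn h U := hhd'.continuousOn
  have hh0 : ∀ z ∈ U, h z ≠ 0 := fun z hz h0 ↦ hψ0 z hz (by
    rw [← hh z, h0]
    norm_num)
  have hhd : DifferentiableOn ℂ h U := differentiableOn_of_sq_eq hU hhc hψd (fun z _ ↦ hh z) hh0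
  have hh1 : ∀ z ∈ U, ‖h z‖ < 1 := fun z hz ↦ by
    have h2 : ‖h z‖ ^ 2 < 1 := by
      rw [← norm_pow, hh z]
      exact hψ1 z hz
    nlinarith [norm_nonneg (h z)]
  have hhm : MapsTo h U (ball 0 1) := fun z hz ↦ mem_ball_zero_iff.2 (hh1 z hz)
  have hhi : InjOn h U := by
    intro a ha b hb hab
    refine hf.injOn ha hb (injOn_discMobius hw1 (hf.mapsTo ha) (hf.mapsTo hb) ?_)
    change ψ a = ψ b
    rw [← hh a, ← hh b, hab]
  have hderivh : ∀ z ∈ U, deriv h z = deriv (discMobius w) (f z) * deriv f z / (2 * h z) := by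
    intro z hz
    rw [deriv_of_sq_eq hU hhc hψd (fun z _ ↦ hh z) hz (hh0 z hz), hψ,
      deriv_comp z (differentiableAt_discMobius hw1 (hf.norm_lt_one hz).le)
        (hf.differentiableOn.differentiableAt (hU.mem_nhds hz))]
  have hhd0 : ∀ z ∈ U, deriv h z ≠ 0 := fun z hz ↦ by
    rw [hderivh z hz]
    exact div_ne_zero
      (mul_ne_zero (deriv_discMobius_ne_zero hw1 (hf.norm_lt_one hz).le) (hf.deriv_ne_zero z hz))
      (mul_ne_zero two_ne_zero (hh0 z hz))
  -- `g := φ_{h z₀} ∘ h ∈ 𝓕`, so `‖g'(z₀)‖ ≤ ‖f'(z₀)‖`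
  have hg : IsRMCandidate U z₀ (discMobius (h z₀) ∘ h) :=
    IsRMCandidate.discMobius_comp hU hhd hhm hhi hhd0 hz₀
  have hle := hmax _ hg
  -- compute `‖g'(z₀)‖`
  set b := h z₀ with hb
  have hb1 : ‖b‖ < 1 := hh1 z₀ hz₀
  have hb0 : 0 < ‖b‖ := norm_pos_iff.2 (hh0 z₀ hz₀)
  have hbw : ‖b‖ ^ 2 = ‖w‖ := by
    rw [← norm_pow, hh z₀]
    change ‖discMobius w (f z₀)‖ = ‖w‖
    rw [hf.eq_zero, discMobius_zero, norm_neg]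
  have hderivg : deriv (discMobius (h z₀) ∘ h) z₀ =
      1 / (1 - conj b * b) * ((1 - conj w * w) * deriv f z₀ / (2 * b)) := by
    rw [deriv_comp z₀ (differentiableAt_discMobius hb1 hb1.le)
      (hhd.differentiableAt (hU.mem_nhds hz₀)), deriv_discMobius_self hb1, hderivh z₀ hz₀,
      hf.eq_zero, deriv_discMobius_zero]
  have hnormg : ‖deriv (discMobius (h z₀) ∘ h) z₀‖ =
      1 / (1 - ‖b‖ ^ 2) * ((1 - ‖w‖ ^ 2) * ‖deriv f z₀‖ / (2 * ‖b‖)) := by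
    rw [hderivg, norm_mul, norm_div, norm_div, norm_mul, norm_mul, norm_one,
      norm_one_sub_conj_mul_self hb1, norm_one_sub_conj_mul_self hw1, Complex.norm_two]
  have hfpos : 0 < ‖deriv f z₀‖ := norm_pos_iff.2 (hf.deriv_ne_zero z₀ hz₀)
  rw [hnormg, ← hbw] at hle
  have hb2 : 0 < 1 - ‖b‖ ^ 2 := by nlinarith
  have key : 1 / (1 - ‖b‖ ^ 2) * ((1 - (‖b‖ ^ 2) ^ 2) * ‖deriv f z₀‖ / (2 * ‖b‖)) =
      (1 + ‖b‖ ^ 2) * ‖deriv f z₀‖ / (2 * ‖b‖) := by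
    field_simp
    ring
  rw [key, div_le_iff₀ (by positivity)] at hle
  nlinarith [mul_pos hfpos (pow_pos (sub_pos.2 hb1) 2)]

/-! ### The Riemann mapping theorem -/

/-- **Conway's Lemma VII.4.3** (the Riemann mapping theorem from the square-root property): let
`U ⊊ ℂ` be open and connected such that every zero-free holomorphic function on `U` has a
holomorphic square root, and let `z₀ ∈ U`. Then there is a holomorphic bijection `f : U → 𝔻` onto
the open unit disc with `f z₀ = 0`, zero-free derivative on `U`, and holomorphic inverse
`Function.invFunOn f U` on `𝔻`. (Conway normalises `f'(z₀) > 0`; we do not.) This form is what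
proves that connected open sets with the square-root property are simply connected (Conway
VIII.2.2). [cite: Conway1978, Ch. VII Lemma 4.3] -/
theorem exists_bijOn_ball_of_hasSqrt (hU : IsOpen U) (hUc : IsPreconnected U) (hsq : HasSqrt U)
    (hU' : U ≠ univ) {z₀ : ℂ} (hz₀ : z₀ ∈ U) :
    ∃ f : ℂ → ℂ, DifferentiableOn ℂ f U ∧ BijOn f U (ball 0 1) ∧ f z₀ = 0 ∧
      (∀ z ∈ U, deriv f z ≠ 0) ∧ DifferentiableOn ℂ (invFunOn f U) (ball 0 1) := by
  obtain ⟨f, hf, hmax⟩ := exists_isRMCandidate_max hU hUc hsq hU' hz₀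
  have hbij : BijOn f U (ball 0 1) := ⟨hf.mapsTo, hf.injOn, hf.surjOn_of_forall_le hU hsq hz₀ hmax⟩
  refine ⟨f, hf.differentiableOn, hbij, hf.eq_zero, hf.deriv_ne_zero, ?_⟩
  rw [← hbij.image_eq]
  exact differentiableOn_invFunOn_image hU hf.differentiableOn hf.injOn hf.deriv_ne_zero

/-- **The Riemann mapping theorem** (Conway VII.4.2; Ahlfors Ch. 6 §1.1 Thm. 1), existence part,
based form: for `U ⊊ ℂ` open and simply connected and `z₀ ∈ U` there is a holomorphic bijection
`f : U → 𝔻` onto the open unit disc with `f z₀ = 0`, zero-free derivative on `U`, and holomorphic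
inverse `Function.invFunOn f U` on `𝔻`. [cite: Conway1978, Ch. VII Thm. 4.2] -/
theorem exists_bijOn_ball_of_isSimplyConnected (hU : IsOpen U) (hsc : IsSimplyConnected U)
    (hU' : U ≠ univ) {z₀ : ℂ} (hz₀ : z₀ ∈ U) :
    ∃ f : ℂ → ℂ, DifferentiableOn ℂ f U ∧ BijOn f U (ball 0 1) ∧ f z₀ = 0 ∧
      (∀ z ∈ U, deriv f z ≠ 0) ∧ DifferentiableOn ℂ (invFunOn f U) (ball 0 1) :=
  exists_bijOn_ball_of_hasSqrt hU hsc.isPathConnected.isConnected.isPreconnected (hsc.hasSqrt hU)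
    hU' hz₀

/-- **The Riemann mapping theorem** (Conway VII.4.2; Ahlfors Ch. 6 §1.1 Thm. 1), existence part:
every simply connected open proper subset `U ⊊ ℂ` admits a holomorphic bijection onto the open unit
disc with holomorphic inverse. (`U` is nonempty by `IsSimplyConnected.nonempty`.) [cite: Conway1978, Ch. VII Thm. 4.2] -/
theorem exists_bijOn_ball_differentiableOn_invFunOn (hU : IsOpen U) (hsc : IsSimplyConnected U)
    (hU' : U ≠ univ) :
    ∃ f : ℂ → ℂ, DifferentiableOn ℂ f U ∧ BijOn f U (ball 0 1) ∧
      DifferentiableOn ℂ (invFunOn f U) (ball 0 1) := by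
  obtain ⟨z₀, hz₀⟩ := hsc.nonempty
  obtain ⟨f, hd, hbij, -, -, hinv⟩ := exists_bijOn_ball_of_isSimplyConnected hU hsc hU' hz₀
  exact ⟨f, hd, hbij, hinv⟩

end Complex

end
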